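import Summits.QuantumFields.YangMills.Theorems.SourcedPressureJensenColdBoxSourcedPressureDefs
import HarnessLib

/-!
# `ColdBoxSourcedPressure` (KS1′, stmt-QuantumFields-23996), line «birth»: the source as a `ℤ⁴` cylinder observable

Sequel of `SourcedPressureJensenColdBoxSourcedPressureDefs.lean` (must land after it): the route's pair source `cellSource` (torus
encoding) is the periodic lift of a `ℤ⁴` cylinder observable `cellSourceZd = Σ_{z ∈ cellPairSites ℓ n} pairDensity z` supported on
the bonds of the cube `B_{ℓ+1} = halfOpenBox 4 (ℓ+1)`; hence, by the bridge `integral_comp_torusLift_freeCellState`,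

* `integral_cellSource_freeCellState` — `E_ν[X] = zdExpect r.ρ β B_{ℓ+1} (cellSourceZd …)` (the object of `stub_firstOrder`),
* `integral_exp_cellSource_freeCellState` — `∫ e^{−hX} dν = zdExpect r.ρ β B_{ℓ+1} (e^{−h·cellSourceZd})` (the sourced free-cell ratio),

both independent of the ambient torus (`ℓ + 1 ≤ L`).  Definitions `cellPairSites`, `pairDensity`, `cellSourceZd` (route-posited,
reviewed).  RECORD-label rung support; the Yang–Mills mass gap is NOT proved by anything here.
-/

set_option autoImplicit false

noncomputable section

open MeasureTheory Finset
open Literature.Probability.LatticeModels Literature.MathematicalPhysics.QuantumLattice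
open Literature.MathematicalPhysics.QuantumFieldTheory Literature.MathematicalPhysics.QuantumFieldTheory.AreaLaw
open Summit.QuantumFields.YangMills.Theorems.WeakCouplingRates
open Summit.QuantumFields.YangMills.Theorems.SourcedPressureJensen

namespace Summit.QuantumFields.YangMills.Cruxes.ColdBoxSourcedPressure.Birth

variable {G : Type} [Group G] [TopologicalSpace G] [IsTopologicalGroup G] [CompactSpace G]
  [MeasurableSpace G] [BorelSpace G]

/-! ### The source as a `ℤ⁴` cylinder observable -/

/-- The base sites of the pairs `(z, z + ne₀)` inside the cell: `z ∈ [0,ℓ]⁴` with `z₁+1 ≤ ℓ`, `z₂+1 ≤ ℓ`, `z₀+n ≤ ℓ`. -/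
def cellPairSites (ℓ n : ℕ) : Finset (Literature.Probability.LatticeModels.Site 4) :=
  (halfOpenBox 4 (ℓ + 1)).filter fun z => z 1 + 1 ≤ (ℓ : ℤ) ∧ z 2 + 1 ≤ (ℓ : ℤ) ∧ z 0 + (n : ℤ) ≤ (ℓ : ℤ)

/-- The pair density at `z ∈ ℤ⁴`: `(βc_z − m)(βc_{z+ne₀} − m)` on `ℤ⁴` configurations (the route's integrand, read at the integer site). -/
def pairDensity (r : LatticeRep G) (β m : ℝ) (n : ℕ) (z : Literature.Probability.LatticeModels.Site 4) (V : LGConfig 4 G) : ℝ :=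
  (β * plaqCost0 (d := 4) r.ρ 1 2 (configShift (-z) V) - m) *
    (β * plaqCost0 (d := 4) r.ρ 1 2 (timeShiftLG (G := G) n (configShift (-z) V)) - m)

/-- The source as a `ℤ⁴` cylinder observable: `X^{ℤ}(V) = Σ_{z ∈ cellPairSites ℓ n} (βc_z − m)(βc_{z+ne₀} − m)` (no ambient torus). -/
def cellSourceZd (r : LatticeRep G) (β m : ℝ) (ℓ n : ℕ) (V : LGConfig 4 G) : ℝ :=
  ∑ z ∈ cellPairSites ℓ n, pairDensity r β m n z V

omit [IsTopologicalGroup G] [CompactSpace G] [BorelSpace G] in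
/-- The shifted origin plaquette cost is the cost of the plaquette at `z`: `c(θ_{−z}V)_{0;ij} = N − Re tr ρ(V_{z;ij})`. -/
theorem plaqCost0_configShift_neg (r : LatticeRep G) (i j : Fin 4) (z : Literature.Probability.LatticeModels.Site 4) (V : LGConfig 4 G) :
    plaqCost0 (d := 4) r.ρ i j (configShift (-z) V) = (r.N : ℝ) - (r.ρ (plaquetteHolonomyZd V z i j)).trace.re := by
  have h : plaquetteHolonomyZd (configShift (-z) V) 0 i j = plaquetteHolonomyZd V z i j := by
    simp only [plaquetteHolonomyZd, Literature.MathematicalPhysics.QuantumLattice.configShift_apply, sub_neg_eq_add, zero_add,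
      add_comm (Pi.single _ (1 : ℤ)) z]
  simp only [plaqCost0, plaquetteObs, h]

omit [IsTopologicalGroup G] [CompactSpace G] [BorelSpace G] in
/-- The time-shifted, shifted origin plaquette cost is the cost of the plaquette at `z + ne₀`. -/
theorem plaqCost0_timeShiftLG_configShift_neg (r : LatticeRep G) (i j : Fin 4) (n : ℕ)
    (z : Literature.Probability.LatticeModels.Site 4) (V : LGConfig 4 G) :
    plaqCost0 (d := 4) r.ρ i j (timeShiftLG (G := G) n (configShift (-z) V)) =
      (r.N : ℝ) - (r.ρ (plaquetteHolonomyZd V (z + Pi.single 0 (n : ℤ)) i j)).trace.re := by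
  have h : plaquetteHolonomyZd (timeShiftLG (G := G) n (configShift (-z) V)) 0 i j =
      plaquetteHolonomyZd V (z + Pi.single 0 (n : ℤ)) i j := by
    have e1 : ∀ y : Literature.Probability.LatticeModels.Site 4,
        y - -(Pi.single (0 : Fin 4) (n : ℤ)) - -z = (z + Pi.single 0 (n : ℤ)) + y := by
      intro y; abel
    simp only [plaquetteHolonomyZd, timeShiftLG, Literature.MathematicalPhysics.QuantumLattice.configShift_apply, e1, add_zero,
      zero_add]
  simp only [plaqCost0, plaquetteObs, h]

omit [TopologicalSpace G] [IsTopologicalGroup G] [CompactSpace G] [MeasurableSpace G] [BorelSpace G] in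
/-- A plaquette holonomy is determined by the configuration on the plaquette's four bonds. -/
theorem plaquetteHolonomyZd_congr_of_bonds {U V : LGConfig 4 G} (x : Literature.Probability.LatticeModels.Site 4) (i j : Fin 4)
    (h : ∀ e ∈ (Plaq.bonds ((x, i, j) : Plaq 4) : Finset (Literature.MathematicalPhysics.QuantumLattice.ZdEdge 4)), U e = V e) :
    plaquetteHolonomyZd U x i j = plaquetteHolonomyZd V x i j := by
  unfold plaquetteHolonomyZd
  rw [h (x, i) (by simp [Plaq.bonds]), h (x + Pi.single i 1, j) (by simp [Plaq.bonds]),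
    h (x + Pi.single j 1, i) (by simp [Plaq.bonds]), h (x, j) (by simp [Plaq.bonds])]

omit [IsTopologicalGroup G] [CompactSpace G] [BorelSpace G] in
/-- The pair density at `z` depends only on the bonds of the plaquettes `(z;1,2)` and `(z+ne₀;1,2)`. -/
theorem dependsOn_pairDensity (r : LatticeRep G) (β m : ℝ) (n : ℕ) (z : Literature.Probability.LatticeModels.Site 4) :
    DependsOn (pairDensity r β m n z)
      (((Plaq.bonds ((z, 1, 2) : Plaq 4) ∪ Plaq.bonds ((z + Pi.single 0 (n : ℤ), 1, 2) : Plaq 4) :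
        Finset (Literature.MathematicalPhysics.QuantumLattice.ZdEdge 4)) : Set (Literature.MathematicalPhysics.QuantumLattice.ZdEdge 4))) := by
  intro U V hUV
  have h1 : plaquetteHolonomyZd U z 1 2 = plaquetteHolonomyZd V z 1 2 :=
    plaquetteHolonomyZd_congr_of_bonds z 1 2 fun e he => hUV e (Finset.mem_coe.2 (Finset.mem_union_left _ he))
  have h2 : plaquetteHolonomyZd U (z + Pi.single 0 (n : ℤ)) 1 2 = plaquetteHolonomyZd V (z + Pi.single 0 (n : ℤ)) 1 2 :=
    plaquetteHolonomyZd_congr_of_bonds _ 1 2 fun e he => hUV e (Finset.mem_coe.2 (Finset.mem_union_right _ he))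
  have hA : plaqCost0 (d := 4) r.ρ 1 2 (configShift (-z) U) = plaqCost0 (d := 4) r.ρ 1 2 (configShift (-z) V) := by
    rw [plaqCost0_configShift_neg r 1 2 z U, plaqCost0_configShift_neg r 1 2 z V, h1]
  have hB : plaqCost0 (d := 4) r.ρ 1 2 (timeShiftLG (G := G) n (configShift (-z) U)) =
      plaqCost0 (d := 4) r.ρ 1 2 (timeShiftLG (G := G) n (configShift (-z) V)) := by
    rw [plaqCost0_timeShiftLG_configShift_neg r 1 2 n z U, plaqCost0_timeShiftLG_configShift_neg r 1 2 n z V, h2]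
  show (β * plaqCost0 (d := 4) r.ρ 1 2 (configShift (-z) U) - m) *
      (β * plaqCost0 (d := 4) r.ρ 1 2 (timeShiftLG (G := G) n (configShift (-z) U)) - m) =
    (β * plaqCost0 (d := 4) r.ρ 1 2 (configShift (-z) V) - m) *
      (β * plaqCost0 (d := 4) r.ρ 1 2 (timeShiftLG (G := G) n (configShift (-z) V)) - m)
  rw [hA, hB]

omit [TopologicalSpace G] [IsTopologicalGroup G] [CompactSpace G] [MeasurableSpace G] [BorelSpace G] in
/-- Both plaquettes of a pair inside the cell are plaquettes of the cube `B_{ℓ+1}`. -/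
theorem pair_mem_plaquettesIn {ℓ n : ℕ} {z : Literature.Probability.LatticeModels.Site 4} (hz : z ∈ cellPairSites ℓ n) :
    ((z, 1, 2) : Plaq 4) ∈ plaquettesIn (halfOpenBox 4 (ℓ + 1)) ∧
      ((z + Pi.single 0 (n : ℤ), 1, 2) : Plaq 4) ∈ plaquettesIn (halfOpenBox 4 (ℓ + 1)) := by
  rw [cellPairSites, Finset.mem_filter, mem_halfOpenBox] at hz
  obtain ⟨h0, h1, h2, h3⟩ := hz
  have h00 := h0 0; have h01 := h0 1; have h02 := h0 2; have h03 := h0 3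
  constructor
  · rw [Plaq.mem_plaquettesIn]
    refine ⟨mem_halfOpenBox.2 h0, show (1 : Fin 4) < 2 by decide, ?_, ?_, ?_⟩ <;> rw [mem_halfOpenBox] <;> intro k <;>
      fin_cases k <;> simp [Pi.add_apply] <;> omega
  · rw [Plaq.mem_plaquettesIn]
    refine ⟨?_, show (1 : Fin 4) < 2 by decide, ?_, ?_, ?_⟩ <;> rw [mem_halfOpenBox] <;> intro k <;>
      fin_cases k <;> simp [Pi.add_apply] <;> omega

omit [IsTopologicalGroup G] [CompactSpace G] [BorelSpace G] in
/-- **The source depends only on the bonds of the cube's plaquettes.** -/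
theorem dependsOn_cellSourceZd (r : LatticeRep G) (β m : ℝ) (ℓ n : ℕ) :
    DependsOn (cellSourceZd r β m ℓ n) (((plaquettesIn (halfOpenBox 4 (ℓ + 1))).biUnion Plaq.bonds :
      Finset (Literature.MathematicalPhysics.QuantumLattice.ZdEdge 4)) : Set (Literature.MathematicalPhysics.QuantumLattice.ZdEdge 4)) := by
  intro U V h
  unfold cellSourceZd
  refine Finset.sum_congr rfl fun z hz => ?_
  obtain ⟨hp1, hp2⟩ := pair_mem_plaquettesIn hz
  refine dependsOn_pairDensity r β m n z fun e he => h e (Finset.mem_coe.2 ?_)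
  rcases Finset.mem_union.1 (Finset.mem_coe.1 he) with he | he
  · exact Finset.mem_biUnion.2 ⟨_, hp1, he⟩
  · exact Finset.mem_biUnion.2 ⟨_, hp2, he⟩

omit [BorelSpace G] in
/-- The source on `ℤ⁴` is continuous. -/
theorem continuous_cellSourceZd (r : LatticeRep G) (β m : ℝ) (ℓ n : ℕ) : Continuous (cellSourceZd r β m ℓ n) := by
  unfold cellSourceZd pairDensity
  refine continuous_finsetSum _ fun z _ => ?_
  have hc := (continuous_bounded_plaqCost0 (d := 4) r.ρ r.continuous 1 2).1
  have hs : Continuous (configShift (d := 4) (G := G) (-z)) :=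
    continuous_pi fun e => by simp only [Literature.MathematicalPhysics.QuantumLattice.configShift_apply]; exact continuous_apply _
  exact ((continuous_const.mul (hc.comp hs)).sub continuous_const).mul
    ((continuous_const.mul (hc.comp ((continuous_timeShiftLG n).comp hs))).sub continuous_const)

omit [TopologicalSpace G] [IsTopologicalGroup G] [CompactSpace G] [BorelSpace G] in
/-- Membership of `natSite x` in `cellPairSites` is the route's "pair inside" predicate. -/
theorem natSite_mem_cellPairSites_iff {L ℓ n : ℕ} (x : Fin 4 → Fin (L + 1)) :
    natSite x ∈ cellPairSites ℓ n ↔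
      ((∀ k : Fin 4, ((x k : ℕ)) ≤ ℓ) ∧ ((x 1 : ℕ)) + 1 ≤ ℓ ∧ ((x 2 : ℕ)) + 1 ≤ ℓ ∧ ((x 0 : ℕ)) + n ≤ ℓ) := by
  rw [cellPairSites, Finset.mem_filter, mem_halfOpenBox]
  simp only [natSite]
  constructor
  · rintro ⟨h0, h1, h2, h3⟩
    exact ⟨fun k => by have := (h0 k).2; omega, by omega, by omega, by omega⟩
  · rintro ⟨h0, h1, h2, h3⟩
    exact ⟨fun k => ⟨by positivity, by have := h0 k; omega⟩, by omega, by omega, by omega⟩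

omit [IsTopologicalGroup G] [CompactSpace G] [BorelSpace G] in
/-- **The route's source is the `ℤ⁴` source read on the periodic lift**: `cellSource r β m ℓ n L = cellSourceZd r β m ℓ n ∘ torusLift (L+1)`
(`ℓ + 1 ≤ L`). -/
theorem cellSource_eq_cellSourceZd_torusLift (r : LatticeRep G) (β m : ℝ) {ℓ L : ℕ} (hL : ℓ + 1 ≤ L) (n : ℕ)
    (U : GaugeConfig 4 (L + 1) G) :
    cellSource r β m ℓ n L U = cellSourceZd r β m ℓ n (torusLift (L + 1) U) := by
  classical
  unfold cellSource cellSourceZd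
  -- the summand at `x` is the pair density at `natSite x` of the periodic lift
  have hterm : ∀ x : Fin 4 → Fin (L + 1),
      toTorusObservable (L + 1) (fun V => (β * plaqCost0 (d := 4) r.ρ 1 2
        (configShift (fun k => -((x k : ℕ) : ℤ)) V) - m) * (β * plaqCost0 (d := 4) r.ρ 1 2
          (timeShiftLG (G := G) n (configShift (fun k => -((x k : ℕ) : ℤ)) V)) - m)) U =
        pairDensity r β m n (natSite x) (torusLift (L + 1) U) := fun x => rfl
  simp_rw [hterm]
  rw [← Finset.sum_filter]
  refine Finset.sum_bij' (fun x _ => natSite x)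
    (fun z _ => fun k => (⟨(z k).toNat % (L + 1), Nat.mod_lt _ (Nat.succ_pos L)⟩ : Fin (L + 1))) ?_ ?_ ?_ ?_ ?_
  · intro x hx
    exact (natSite_mem_cellPairSites_iff x).2 (Finset.mem_filter.1 hx).2
  · intro z hz
    have hz' := hz
    rw [cellPairSites, Finset.mem_filter, mem_halfOpenBox] at hz'
    obtain ⟨h0, h1, h2, h3⟩ := hz'
    have hlt : ∀ k, (z k).toNat < L + 1 := fun k => by have := h0 k; omega
    have hmod : ∀ k, (z k).toNat % (L + 1) = (z k).toNat := fun k => Nat.mod_eq_of_lt (hlt k)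
    have hcast : ∀ k, (((z k).toNat : ℕ) : ℤ) = z k := fun k => Int.toNat_of_nonneg (h0 k).1
    rw [Finset.mem_filter]
    simp only [Finset.mem_univ, true_and]
    refine ⟨fun k => ?_, ?_, ?_, ?_⟩
    · have := hmod k; have := hcast k; have := h0 k; omega
    · have := hmod 1; have := hcast 1; omega
    · have := hmod 2; have := hcast 2; omega
    · have := hmod 0; have := hcast 0; omega
  · intro x _
    funext k
    apply Fin.ext
    simp only [natSite, Int.toNat_natCast]
    exact Nat.mod_eq_of_lt (x k).isLt
  · intro z hz
    rw [cellPairSites, Finset.mem_filter, mem_halfOpenBox] at hz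
    obtain ⟨h0, -, -, -⟩ := hz
    funext k
    have hk := h0 k
    have hlt : (z k).toNat < L + 1 := by omega
    show (((z k).toNat % (L + 1) : ℕ) : ℤ) = z k
    rw [Nat.mod_eq_of_lt hlt]
    omega
  · intro x _
    rfl

/-- **The mean of the source under the free-cell state is a Chatterjee free-cube expectation**:
`∫ cellSource dν = zdExpect r.ρ β (halfOpenBox 4 (ℓ+1)) (cellSourceZd r β m ℓ n)` (`ℓ + 1 ≤ L`; independent of `L`). -/
theorem integral_cellSource_freeCellState (r : LatticeRep G) (β m : ℝ) {ℓ L : ℕ} (hL : ℓ + 1 ≤ L) (n : ℕ) :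
    ∫ U, cellSource r β m ℓ n L U ∂(freeCellState r β ℓ L) = zdExpect r.ρ β (halfOpenBox 4 (ℓ + 1)) (cellSourceZd r β m ℓ n) := by
  haveI := r.secondCountableTopology
  simp_rw [cellSource_eq_cellSourceZd_torusLift r β m hL n]
  exact integral_comp_torusLift_freeCellState r β hL (continuous_cellSourceZd r β m ℓ n).measurable (dependsOn_cellSourceZd r β m ℓ n)

/-- **The sourced free-cell partition ratio is a Chatterjee free-cube expectation**:
`∫ e^{−h·cellSource} dν = zdExpect r.ρ β (halfOpenBox 4 (ℓ+1)) (e^{−h·cellSourceZd})` (`ℓ + 1 ≤ L`; independent of `L`). -/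
theorem integral_exp_cellSource_freeCellState (r : LatticeRep G) (β m : ℝ) {ℓ L : ℕ} (hL : ℓ + 1 ≤ L) (n : ℕ) (h : ℝ) :
    ∫ U, Real.exp (-h * cellSource r β m ℓ n L U) ∂(freeCellState r β ℓ L) =
      zdExpect r.ρ β (halfOpenBox 4 (ℓ + 1)) (fun V => Real.exp (-h * cellSourceZd r β m ℓ n V)) := by
  haveI := r.secondCountableTopology
  simp_rw [cellSource_eq_cellSourceZd_torusLift r β m hL n]
  exact integral_comp_torusLift_freeCellState r β hL
    (Real.measurable_exp.comp ((continuous_cellSourceZd r β m ℓ n).measurable.const_mul _))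
    (dependsOn_comp (dependsOn_cellSourceZd r β m ℓ n) fun s => Real.exp (-h * s))

end Summit.QuantumFields.YangMills.Cruxes.ColdBoxSourcedPressure.Birth

end
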